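import Summits.BirchSwinnertonDyer.BirchSwinnertonDyer.Theorems.ResidualThetaTransportAtTwoRelativeLubinTateSeries
import HarnessLib

/-!
# The formal group of a supersingular model with `a_p = 0` is RELATIVE LUBIN–TATE for `(π, q) = (−p, p²)`, II:
# `F_V ⊗ A = F_{f_V}` (Lubin–Tate's group of `f_V = i([p] X)`), the formal `A`-module structure `[a]_V` (`a ∈ A`),
# Galois semilinearity, and the `A`-linear comparison of two models — at `p = 2`: `Ŵ ⊗ ℤ₄` is a formal `ℤ₄`-module with `[ω]` of order `3`
# (Kobayashi 2003, Prop. 8.6 / de Shalit's relative Lubin–Tate groups, at every prime; kernel)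

Route `ResidualThetaTransportAtTwo` (RTT), rank-2 crux `ResidualThetaCountLowerAtTwo` (stmt-BirchSwinnertonDyer-25435) / (R≥) of
`Cruxes/ResidualThetaCountAtTwo/RGE-RESTATEMENT-g8.md`; seat `prover-bsd-wall-rtt-p2` g9 (`--supports`, closes nothing). Sequel of
`…RelativeLubinTateSeries` (`f_V ∈ 𝔉_{−p}` for `q = p²`; Lubin–Tate bases for `(−p, p²)`).
HONEST FRAMING: THEOREMS ONLY (no definition, no named fact, no instance, no `sorry`); route-independent (no `Theses` import);
pure formal-group algebra; nothing about any Selmer group; BSD is not proved by any of this.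

WHAT (`V/ℤ_p` with elliptic fibres and `tr(V mod p) = 0`; `A` a `ℤ_p`-algebra with `hA : IsLTRing (−p) (p²)`, e.g. `ℤ_p`, `ℤ₄`;
`f := f_V ⊗ A`, `[a]_V := LubinTate.hom hA hf hf a`):
* §3a (any `f ∈ 𝔉_{−p}`, `q = p²`) the formal `A`-module axioms read off Lubin–Tate's `hom`: `hom_module_axioms` (`[a] ∘ [b] = [ab]`,
  `[1] = X`, `[−p] = f`, `[a] ≡ aX`, `f ∘ [a] = [a] ∘ f`), `eq_hom_of_subst` (uniqueness), `compHom_subst_hom` (`[1]_{f',f}` intertwines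
  `[a]_f`, `[a]_{f'}` and is inverted by `[1]_{f,f'}`), `hom_subst_hom_eq_X_of_mul_eq_one` (units act by automorphisms; `[ω]³ = X`).
* §3 `compLeft_eq_compRight_map` (`f ∈ End(F_V ⊗ A)`), **`formalGroupLaw_eq_ltF : (V ⊗ A).formalGroupLaw = LubinTate.ltF hA hf`** —
  `F_V ⊗ A` IS Lubin–Tate's formal group of `f_V` (`formalGroupLaw_eq_formalGroup_toPowerSeries`); whence
  **`formalGroupLaw_subst_hom : F_V([a] X, [a] Y) = [a](F_V(X, Y))`** for every `a ∈ A`, `hom_add_eq` (`[a + b] = F_V([a], [b])`),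
  **`formalMul_eq_hom : V.formalMul n = [n]_V`** (the `A`-module structure extends `Ê`'s `ℤ`-structure), and Galois SEMILINEARITY
  **`map_hom_eq_hom_apply : [a]^σ = [σ a]`** for every ring endomorphism `σ` of `A` over `ℤ_p` (Frobenius of `ℤ₄`).
* §4 `formalGroupLaw_subst_compHom`: two such models `V, V'` have `F_V ⊗ A ≅ F_{V'} ⊗ A` through the strict series
  `[1]_{f_{V'}, f_V}` — Honda's strong isomorphism (Kobayashi Thm. 8.4, B.-D. Kim Prop. 2.11) re-derived from Lubin–Tate, `A`-linear
  by §3a; with a CM partner `B/ℚ₄` whose `[ψ_B(w)] = [−2]` lifts `x ↦ x⁴` this is g7's «`Ŵ ⊗ ℤ₄ ≅ B̂_w`» once `B` is typed.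

References: [Kobayashi2003] S. Kobayashi, Invent. Math. 152 (2003), Thm. 8.4, Cor. 8.5, Prop. 8.6; [LubinTate1965] J. Lubin, J. Tate,
Ann. of Math. 81 (1965), §1 Lemma 1, Thm. 1 (8)–(11); [deShalit1987] E. de Shalit, Ch. I §1.1–1.3; [BDKim2009] B.-D. Kim, Prop. 2.11;
[SilvermanAEC2009] IV.2.3.
-/

set_option autoImplicit false
-- the Theorems namespace of this sub repeats the summit name by design (D-0017 nested layout)
set_option linter.dupNamespace false

noncomputable section

open scoped Classical
open PowerSeries WeierstrassCurve Literature.NumberTheory.EllipticCurves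
  Literature.NumberTheory.GaloisRepresentations

namespace Summit.BirchSwinnertonDyer.BirchSwinnertonDyer.Theorems.RelativeLubinTate

/-! ## §3a Formal `A`-module axioms for a Lubin–Tate series `f ∈ 𝔉_{−p}` (`q = p²`), read off Lubin–Tate's `hom` -/

section Generic

variable {p : ℕ} {A : Type*} [CommRing A] (hA : LubinTate.IsLTRing (-(p : A)) (p ^ 2))

/-- **`[a]_V ∘ [b]_V = [ab]_V`**, `[1]_V = X`, `[−p]_V = f_V ⊗ A`, `[a]_V ≡ aX (mod deg 2)`, and `f_V ∘ [a]_V = [a]_V ∘ f_V`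
— the formal `A`-module axioms, read off Lubin–Tate's `hom`. [cite: LubinTate1965, §1 Thm. 1 (9), (11)] -/
theorem hom_module_axioms {f : A⟦X⟧} (hf : LubinTate.IsLTSeries (-(p : A)) (p ^ 2) f) (a b : A) :
    PowerSeries.subst (LubinTate.hom hA hf hf b) (LubinTate.hom hA hf hf a) = LubinTate.hom hA hf hf (a * b) ∧
      LubinTate.hom hA hf hf 1 = PowerSeries.X ∧ LubinTate.hom hA hf hf (-(p : A)) = f ∧
      constantCoeff (LubinTate.hom hA hf hf a) = 0 ∧ coeff 1 (LubinTate.hom hA hf hf a) = a ∧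
      PowerSeries.subst (LubinTate.hom hA hf hf a) f = PowerSeries.subst f (LubinTate.hom hA hf hf a) :=
  ⟨LubinTate.hom_comp_hom hA hf hf hf a b, LubinTate.hom_one hA hf, LubinTate.hom_self_eq hA hf,
    LubinTate.constantCoeff_hom hA hf hf a, LubinTate.coeff_one_hom hA hf hf a, LubinTate.subst_hom hA hf hf a⟩

/-- **Uniqueness of `[a]_V`**: a series `H ≡ aX (mod deg 2)` commuting with `f_V ⊗ A` is `[a]_V`.
[cite: LubinTate1965, §1 Lemma 1] -/
theorem eq_hom_of_subst {f : A⟦X⟧} (hf : LubinTate.IsLTSeries (-(p : A)) (p ^ 2) f) {a : A} {H : A⟦X⟧}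
    (h0 : constantCoeff H = 0) (h1 : coeff 1 H = a) (h2 : PowerSeries.subst H f = PowerSeries.subst f H) :
    H = LubinTate.hom hA hf hf a :=
  LubinTate.eq_hom hA hf hf h0 h1 h2

/-- **`A`-linearity of the comparison and its inverse**: for Lubin–Tate series `f, f' ∈ 𝔉_{−p}` over `A`,
`[1]_{f',f} ∘ [a]_f = [a]_{f',f} = [a]_{f'} ∘ [1]_{f',f}` and `[1]_{f,f'} ∘ [1]_{f',f} = X`: the comparison series
intertwines the two `A`-module structures and is invertible. [cite: LubinTate1965, §1 Thm. 1 (9), (11)] -/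
theorem compHom_subst_hom {f f' : A⟦X⟧} (hf : LubinTate.IsLTSeries (-(p : A)) (p ^ 2) f)
    (hf' : LubinTate.IsLTSeries (-(p : A)) (p ^ 2) f') (a : A) :
    PowerSeries.subst (LubinTate.hom hA hf hf a) (LubinTate.hom hA hf' hf 1) =
        PowerSeries.subst (LubinTate.hom hA hf' hf 1) (LubinTate.hom hA hf' hf' a) ∧
      PowerSeries.subst (LubinTate.hom hA hf' hf 1) (LubinTate.hom hA hf hf' 1) = PowerSeries.X := by
  refine ⟨?_, ?_⟩
  · rw [LubinTate.hom_comp_hom hA hf' hf hf 1 a, LubinTate.hom_comp_hom hA hf' hf' hf a 1, one_mul, mul_one]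
  · rw [LubinTate.hom_comp_hom hA hf hf' hf 1 1, mul_one, LubinTate.hom_one hA hf]

/-- **Units act by automorphisms**: if `a b = 1` in `A` then `[a] ∘ [b] = X = [b] ∘ [a]`; e.g. at `p = 2` over
`ℤ₄ ∋ ω`, `ω³ = 1`, the endomorphism `[ω]` is an automorphism of order dividing `3` with inverse `[ω²]`.
[cite: LubinTate1965, §1 Thm. 1 (9), (11)] -/
theorem hom_subst_hom_eq_X_of_mul_eq_one {f : A⟦X⟧} (hf : LubinTate.IsLTSeries (-(p : A)) (p ^ 2) f) {a b : A}
    (hab : a * b = 1) :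
    PowerSeries.subst (LubinTate.hom hA hf hf b) (LubinTate.hom hA hf hf a) = PowerSeries.X ∧
      PowerSeries.subst (LubinTate.hom hA hf hf a) (LubinTate.hom hA hf hf b) = PowerSeries.X := by
  rw [LubinTate.hom_comp_hom hA hf hf hf a b, LubinTate.hom_comp_hom hA hf hf hf b a, mul_comm b a, hab,
    LubinTate.hom_one hA hf]
  exact ⟨rfl, rfl⟩

end Generic

/-! ## §3 `F_V ⊗ A` is Lubin–Tate's `F_{f_V}`; the formal `A`-module structure -/

section Module

variable {p : ℕ} [hp : Fact p.Prime] (V : WeierstrassCurve ℤ_[p]) {A : Type*} [CommRing A] [Algebra ℤ_[p] A]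

/-- `f_V ⊗ A` is the series `i([p] X)` of the base-changed model `V ⊗ A`. [folklore] -/
theorem map_algebraMap_formalNeg_subst_formalMul :
    PowerSeries.map (algebraMap ℤ_[p] A) (V.formalNeg.subst (V.formalMul p)) =
      (V.map (algebraMap ℤ_[p] A)).formalNeg.subst ((V.map (algebraMap ℤ_[p] A)).formalMul p) :=
  map_formalNeg_subst_formalMul V _ p

/-- `f_V ⊗ A` is an endomorphism of `F_V ⊗ A` (`compLeft = compRight` in Lubin–Tate's notation).
[cite: LubinTate1965, §1 (4)] -/
theorem compLeft_eq_compRight_map :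
    LubinTate.compLeft (PowerSeries.map (algebraMap ℤ_[p] A) (V.formalNeg.subst (V.formalMul p)))
        (V.map (algebraMap ℤ_[p] A)).formalGroupLaw =
      LubinTate.compRight (PowerSeries.map (algebraMap ℤ_[p] A) (V.formalNeg.subst (V.formalMul p)))
        (V.map (algebraMap ℤ_[p] A)).formalGroupLaw := by
  set φ := algebraMap ℤ_[p] A with hφ
  set θ : ℤ_[p]⟦X⟧ := V.formalNeg.subst (V.formalMul p) with hθ
  have hθ0 : constantCoeff θ = 0 := constantCoeff_formalNeg_subst_formalMul V p
  have hF : HasSubst V.formalGroupLaw := HasSubst.of_constantCoeff_zero V.constantCoeff_formalGroupLaw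
  have hb0 : ∀ i : Fin 2, MvPowerSeries.constantCoeff
      (PowerSeries.subst (MvPowerSeries.X i : MvPowerSeries (Fin 2) ℤ_[p]) θ) = 0 :=
    fun i ↦ constantCoeff_subst_eq_zero (MvPowerSeries.constantCoeff_X i) _ hθ0
  have hbs : MvPowerSeries.HasSubst
      (fun i : Fin 2 ↦ PowerSeries.subst (MvPowerSeries.X i : MvPowerSeries (Fin 2) ℤ_[p]) θ) :=
    MvPowerSeries.hasSubst_of_constantCoeff_zero hb0
  have h := formalNeg_subst_formalMul_subst_formalGroupLaw V p
  rw [← hθ] at h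
  have h' := congrArg (MvPowerSeries.map φ) h
  rw [map_subst hF, map_formalGroupLaw, MvPowerSeries.map_subst hbs, map_formalGroupLaw] at h'
  have hb : (fun i : Fin 2 ↦ MvPowerSeries.map φ
      (PowerSeries.subst (MvPowerSeries.X i : MvPowerSeries (Fin 2) ℤ_[p]) θ)) =
      fun i : Fin 2 ↦ PowerSeries.subst (MvPowerSeries.X i : MvPowerSeries (Fin 2) A) (PowerSeries.map φ θ) := by
    funext i
    rw [map_subst (HasSubst.X i), MvPowerSeries.map_X]
  rw [hb] at h'
  unfold LubinTate.compLeft LubinTate.compRight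
  exact h'

variable [hE : (V.map PadicInt.Coe.ringHom).IsElliptic] [hEt : (V.map PadicInt.toZMod).IsElliptic]
  (htr : Literature.NumberTheory.EllipticCurves.HasseManin.tr (V.map PadicInt.toZMod) = 0)
  (hA : LubinTate.IsLTRing (-(p : A)) (p ^ 2))

include htr in
/-- The Lubin–Tate series of `V` over the `ℤ_p`-algebra `A`: `f_V ⊗ A ∈ 𝔉_{−p}` (`q = p²`).
[cite: Kobayashi2003, Prop. 8.6] -/
theorem isLTSeries_map_formalNeg_subst_formalMul :
    LubinTate.IsLTSeries (-(p : A)) (p ^ 2)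
      (PowerSeries.map (algebraMap ℤ_[p] A) (V.formalNeg.subst (V.formalMul p))) := by
  have h := isLTSeries_map (algebraMap ℤ_[p] A) (isLTSeries_formalNeg_subst_formalMul V htr)
  rwa [map_neg, map_natCast] at h



/-- **`F_V ⊗ A = F_{f_V}`, LUBIN–TATE'S FORMAL GROUP OF `f_V`** (`tr(V mod p) = 0`, `A` a Lubin–Tate base for `(−p, p²)`):
the chord–tangent law of `V ⊗ A` is the unique `F ≡ X + Y (mod deg 2)` with `f_V ∘ F = F ∘ (f_V × f_V)`. This is
Kobayashi's Prop. 8.6 / de Shalit's relative Lubin–Tate structure, for the curve's own formal group and at every prime.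
[cite: Kobayashi2003, Prop. 8.6] [cite: LubinTate1965, §1 Thm. 1] -/
theorem formalGroupLaw_eq_ltF :
    (V.map (algebraMap ℤ_[p] A)).formalGroupLaw =
      LubinTate.ltF hA (isLTSeries_map_formalNeg_subst_formalMul V htr (A := A)) := by
  refine LubinTate.eq_limit hA _ _ (V.map _).constantCoeff_formalGroupLaw (fun i ↦ ?_)
    (compLeft_eq_compRight_map V (A := A))
  have h := congrArg (MvPowerSeries.coeff (Finsupp.single i 1)) (V.map_formalGroupLaw (algebraMap ℤ_[p] A))
  rw [MvPowerSeries.coeff_map, coeff_single_formalGroupLaw V, map_one] at h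
  exact h.symm


/-- `F_V ⊗ A` is the series underlying Mathlib's `FormalGroup` `LubinTate.formalGroup` of `f_V`. [cite: LubinTate1965, §1 Thm. 1] -/
theorem formalGroupLaw_eq_formalGroup_toPowerSeries :
    (V.map (algebraMap ℤ_[p] A)).formalGroupLaw =
      (LubinTate.formalGroup hA (isLTSeries_map_formalNeg_subst_formalMul V htr (A := A))).toPowerSeries := by
  rw [LubinTate.formalGroup_toPowerSeries]
  exact formalGroupLaw_eq_ltF V htr hA

/-! ### The endomorphisms `[a]_V`, `a ∈ A` -/

/-- **`[a]_V` is an endomorphism of `F_V ⊗ A`**: `F_V([a] X, [a] Y) = [a](F_V(X, Y))` for every `a ∈ A`, where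
`[a]_V := LubinTate.hom hA hf hf a` is Lubin–Tate's `[a]_{f,f}` for `f = f_V ⊗ A`. [cite: LubinTate1965, §1 Thm. 1 (8)] -/
theorem formalGroupLaw_subst_hom (a : A) :
    MvPowerSeries.subst ![LubinTate.homX hA (isLTSeries_map_formalNeg_subst_formalMul V htr (A := A))
        (isLTSeries_map_formalNeg_subst_formalMul V htr (A := A)) a (0 : Fin 2),
        LubinTate.homX hA (isLTSeries_map_formalNeg_subst_formalMul V htr (A := A))
        (isLTSeries_map_formalNeg_subst_formalMul V htr (A := A)) a 1]
        (V.map (algebraMap ℤ_[p] A)).formalGroupLaw =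
      PowerSeries.subst (V.map (algebraMap ℤ_[p] A)).formalGroupLaw
        (LubinTate.hom hA (isLTSeries_map_formalNeg_subst_formalMul V htr (A := A))
          (isLTSeries_map_formalNeg_subst_formalMul V htr (A := A)) a) := by
  rw [formalGroupLaw_eq_ltF V htr hA]
  exact LubinTate.ltF_subst_homX hA _ _ a

/-- **`[a + b]_V = F_V([a]_V, [b]_V)`** (additivity of the module structure in the curve's own group law).
[cite: LubinTate1965, §1 Thm. 1 (10)] -/
theorem hom_add_eq (a b : A) :
    LubinTate.hom hA (isLTSeries_map_formalNeg_subst_formalMul V htr (A := A))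
        (isLTSeries_map_formalNeg_subst_formalMul V htr (A := A)) (a + b) =
      MvPowerSeries.subst ![LubinTate.hom hA (isLTSeries_map_formalNeg_subst_formalMul V htr (A := A))
          (isLTSeries_map_formalNeg_subst_formalMul V htr (A := A)) a,
        LubinTate.hom hA (isLTSeries_map_formalNeg_subst_formalMul V htr (A := A))
          (isLTSeries_map_formalNeg_subst_formalMul V htr (A := A)) b]
        (V.map (algebraMap ℤ_[p] A)).formalGroupLaw := by
  rw [formalGroupLaw_eq_ltF V htr hA]
  exact LubinTate.hom_add hA _ _ a b


/-- **The curve's multiplication maps are the Lubin–Tate ones: `[n]_V ⊗ A = [n]_{f_V}`** (`n : ℕ`): `V.formalMul n`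
is `≡ nX`, has no constant term and commutes with `f_V` (§2), so uniqueness applies. In particular the `A`-module
structure EXTENDS the `ℤ`-module structure of `Ê`. [cite: SilvermanAEC2009, IV.2.3] [cite: LubinTate1965, §1 Lemma 1] -/
theorem formalMul_eq_hom (n : ℕ) :
    (V.map (algebraMap ℤ_[p] A)).formalMul n =
      LubinTate.hom hA (isLTSeries_map_formalNeg_subst_formalMul V htr (A := A))
        (isLTSeries_map_formalNeg_subst_formalMul V htr (A := A)) (n : A) := by
  refine LubinTate.eq_hom hA _ _ ((V.map _).constantCoeff_formalMul n) ((V.map _).coeff_one_formalMul' n) ?_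
  -- `f ∘ [n] = [n] ∘ f`, mapped from `ℤ_p`
  have h := congrArg (PowerSeries.map (algebraMap ℤ_[p] A)) (formalMul_subst_formalNeg_subst_formalMul V n p)
  rw [powerSeries_map_subst _ (HasSubst.of_constantCoeff_zero' (constantCoeff_formalNeg_subst_formalMul V p)),
    powerSeries_map_subst _ (HasSubst.of_constantCoeff_zero' (V.constantCoeff_formalMul n)), map_formalMul] at h
  exact h.symm

omit hE hEt in
/-- **Galois semilinearity `[a]^σ = [σ a]`**: for a ring endomorphism `σ` of `A` over `ℤ_p` (e.g. the Frobenius of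
`ℤ₄ = W(𝔽₄)` over `ℤ₂`), applying `σ` to the coefficients of `[a]_V` gives `[σ a]_V` — `f_V` has coefficients in `ℤ_p`, so
`[a]^σ` commutes with `f_V` and has linear term `σ a`. Consequently `Gal(ℚ₄/ℚ₂)` acts `ℤ₄`-SEMILINEARLY on the
`ℤ₄`-module of points. [cite: LubinTate1965, §1 Lemma 1] [cite: deShalit1987, Ch. I §1.2] -/
theorem map_hom_eq_hom_apply {f₀ : ℤ_[p]⟦X⟧} (hf : LubinTate.IsLTSeries (-(p : A)) (p ^ 2) (PowerSeries.map (algebraMap ℤ_[p] A) f₀))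
    (σ : A →+* A) (hσ : ∀ x : ℤ_[p], σ (algebraMap ℤ_[p] A x) = algebraMap ℤ_[p] A x) (a : A) :
    PowerSeries.map σ (LubinTate.hom hA hf hf a) = LubinTate.hom hA hf hf (σ a) := by
  set f := PowerSeries.map (algebraMap ℤ_[p] A) f₀ with hfdef
  have hc : σ.comp (algebraMap ℤ_[p] A) = algebraMap ℤ_[p] A := RingHom.ext hσ
  have hfσ : PowerSeries.map σ f = f := by
    rw [hfdef, ← RingHom.comp_apply (PowerSeries.map σ), ← PowerSeries.map_comp, hc]
  refine LubinTate.eq_hom hA hf hf ?_ ?_ ?_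
  · rw [← coeff_zero_eq_constantCoeff_apply, coeff_map, coeff_zero_eq_constantCoeff_apply,
      LubinTate.constantCoeff_hom, map_zero]
  · rw [coeff_map, LubinTate.coeff_one_hom]
  · have h := congrArg (PowerSeries.map σ) (LubinTate.subst_hom hA hf hf a)
    rw [powerSeries_map_subst _ (HasSubst.of_constantCoeff_zero' (LubinTate.constantCoeff_hom hA hf hf a)),
      powerSeries_map_subst _ (HasSubst.of_constantCoeff_zero' hf.constantCoeff_eq_zero), hfσ] at h
    exact h

end Module

/-! ## §4 Comparison: two models are `A`-linearly isomorphic by `[1]_{f', f}` (Honda's strong isomorphism, `A`-linear) -/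

section Comparison

variable {p : ℕ} [hp : Fact p.Prime] (V V' : WeierstrassCurve ℤ_[p]) [hE : (V.map PadicInt.Coe.ringHom).IsElliptic]
  [hEt : (V.map PadicInt.toZMod).IsElliptic] [hE' : (V'.map PadicInt.Coe.ringHom).IsElliptic]
  [hEt' : (V'.map PadicInt.toZMod).IsElliptic]
  (htr : Literature.NumberTheory.EllipticCurves.HasseManin.tr (V.map PadicInt.toZMod) = 0)
  (htr' : Literature.NumberTheory.EllipticCurves.HasseManin.tr (V'.map PadicInt.toZMod) = 0)
  {A : Type*} [CommRing A] [Algebra ℤ_[p] A] (hA : LubinTate.IsLTRing (-(p : A)) (p ^ 2))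


/-- **The comparison series `u = [1]_{f_{V'}, f_V} ≡ X` is a homomorphism `F_V ⊗ A → F_{V'} ⊗ A`**:
`F_{V'}(u X, u Y) = u(F_V(X, Y))`. With its inverse `[1]_{f_V, f_{V'}}` (`compHom_subst_compHom`) this is Honda's strong
isomorphism `V̂ ≅ V̂'` over `ℤ_p` (two models with `a_p = 0` — Kobayashi Thm. 8.4 / B. D. Kim Prop. 2.11), re-derived from
Lubin–Tate and valid over every base `A`. [cite: Kobayashi2003, Thm. 8.4, Prop. 8.6] [cite: LubinTate1965, §1 Thm. 1 (8)] -/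
theorem formalGroupLaw_subst_compHom :
    MvPowerSeries.subst ![LubinTate.homX hA (isLTSeries_map_formalNeg_subst_formalMul V' htr' (A := A))
        (isLTSeries_map_formalNeg_subst_formalMul V htr (A := A)) 1 (0 : Fin 2),
        LubinTate.homX hA (isLTSeries_map_formalNeg_subst_formalMul V' htr' (A := A))
        (isLTSeries_map_formalNeg_subst_formalMul V htr (A := A)) 1 1]
        (V'.map (algebraMap ℤ_[p] A)).formalGroupLaw =
      PowerSeries.subst (V.map (algebraMap ℤ_[p] A)).formalGroupLaw
        (LubinTate.hom hA (isLTSeries_map_formalNeg_subst_formalMul V' htr' (A := A))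
          (isLTSeries_map_formalNeg_subst_formalMul V htr (A := A)) 1) := by
  rw [formalGroupLaw_eq_ltF V htr hA, formalGroupLaw_eq_ltF V' htr' hA]
  exact LubinTate.ltF_subst_homX hA _ _ 1

end Comparison

end Summit.BirchSwinnertonDyer.BirchSwinnertonDyer.Theorems.RelativeLubinTate

end
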